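/-
Copyright (c) 2026. All rights reserved.
Released under Apache 2.0 license as described in the file LICENSE.
Authors: abc-iut cell, seat abc-iut-f-069 (gen 4; row «DPSC-NODAL-MODEL», complementary half to abc-iut-L4-t6 g7).
-/
import Literature.AnabelianGeometry.AbsoluteAnabelian.AbsTopII.DehnTwistLoopCusp
import Literature.AnabelianGeometry.AbsoluteAnabelian.AbsTopII.DehnTwistLoopProp13i
import Literature.AnabelianGeometry.AbsoluteAnabelian.AbsTopII.InertiaGroupsCuspScope
import HarnessLib

/-!
# [AbsTopII] Prop 1.3 (vi), (vii), (ix) AS TYPED at the NODAL Dehn-twist datum; (iii′) modulo `N(Π_v) = Π_v`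

S. Mochizuki, *Topics in Absolute Anabelian Geometry II* [AbsTopII] (bib `MochizukiAbsTopII2013`; locators =
PDF pages of the kurims manuscript `paper:url-585b8d0ad0d9`), §1, Prop 1.3 (i), (iii) p. 11, (vi), (vii), (ix)
p. 12, at the FIRST DPSC datum WITH A NODE of the tree: abc-iut-L4-t6's `DehnTwist.dpsc i hi` (degenerating
once-punctured torus; `Π_𝔾 = F̂₂`, `Π_e = b^Ẑ`, `Π_v = ⟨b^Ẑ, ab^Ẑa⁻¹⟩^`, `Π_c = ⟨[a,b]⟩^ = c^Ẑ`,
`Π_H = Π_I = F̂₂ ⋊_{shear^i} Ẑ`, `Σ` = all primes, `i^Σ_e = i`; files `DehnTwistExtension` p453388, `DehnTwistLoopDatum`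
p455624, `DehnTwistLoopInertia` p457431, `DehnTwistLoopProp13ii` p458921/p459070).

PROOF-ONLY companion (no definition), abc-iut-f-069 (gen 4) — the half of row «DPSC-NODAL-MODEL» complementary to
abc-iut-L4-t6 g7's (i)/(ii)/(ii′)/(iii first clause + cusp clause) (`DehnTwistLoopProp13ii`, `…Prop13i`,
`…LoopCusp`).  The group theory is `DehnTwistDecompositionGroups` (p459741: `D_e = C = N = Z (Π_e × 1) = b^Ẑ ⋊ Ẑ`
commensurably terminal, the same for the cusp `c^Ẑ`, images in `H` everything, non-openness) and
`DehnTwistFreeGroupInputs` (p458558); here the TRANSFER (definitional: `dpsc_nodeSub`, `dpsc_cuspSub`, `dpsc_PiG`,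
`dpsc_PiI` are `rfl`) to abc-iut-L4-t4 / abc-iut-L4-t6's typed predicates, every conclusion BY NAME and with ZERO
hypotheses unless said:

* `prop13vii_dpsc_holds : (dpsc i hi).toDPSCData.Prop13vii` — **Prop 1.3 (vii)** (F-0280) in full, node AND cusp;
* `prop13ix_dpsc_holds : (dpsc i hi).toDPSCData.Prop13ix` — **Prop 1.3 (ix)** (F-0277) in full, node AND cusp;
* `prop13vi_dpsc_holds : (dpsc i hi).toDPSCData.Prop13vi` — **Prop 1.3 (vi)** (F-0279) (second half vacuous:
  one vertex);
* `prop_1_3_iii'_dpsc_of_normalizer_vertGp_eq`, `prop_1_3_iii''_dpsc_of_normalizer_vertGp_eq` — the FULL typed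
  (iii′) (F-0299) / (iii″) at the nodal datum MODULO the one named input «`N_{F̂₂}(Π_v) = Π_v`» ([CombGC] Prop 1.2
  (ii) for the verticial subgroup `⟨b^Ẑ, ab^Ẑa⁻¹⟩^` of `F̂₂` — NOT in the tree), the cusp conjunct being abc-iut-L4-t6's
  unconditional `prop_1_3_iii_cusp_dpsc_holds` (`DehnTwistLoopCusp`, over p459741); and `dv_inf_PiI_eq_iff`: the
  vertex clause "`D_v ∩ Π_I = I_v × Π_v`" is EQUIVALENT to that input at this datum (so the residual is exact);
* `exists_nodal_model_prop13_i_vi_vii_ix` — packaging: ONE DPSC datum WITH A NODE at which (i), (ii), (ii′),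
  (iii)₁, (vi), (vii), (ix) hold simultaneously with no hypothesis ((i)/(ii)/(iii)₁ by abc-iut-L4-t6's closers).
HONEST FRAMING: classical group theory in a constructed model (constructed ≠ geometric); consistency evidence for
the typed rows, not the printed theorem for stable log curves; nothing here bears on [IUTchIII] Cor 3.12.
-/

noncomputable section

open scoped Pointwise

namespace Literature.AnabelianGeometry.AbsoluteAnabelian.AbsTopII.DehnTwist

open Literature.AnabelianGeometry.EtaleTheta.SettingModel
open Literature.AnabelianGeometry.AbsoluteAnabelian
open Literature.AnabelianGeometry.SemiGraphs
open Function _root_.Topology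

section Dpsc

variable {i : ℕ} (hi : 0 < i)

/-! ### Definitional transfers not yet in the lane's files -/

/-- `Π_c = c^Ẑ × 1` (the cuspidal subgroup of `dpsc`). [cite: MochizukiAbsTopII2013, Def 1.2 (ii) p.10] -/
theorem dpsc_cuspSub (c : (dpsc i hi).Cusp) :
    (dpsc i hi).cuspSub c = cuspGp.map (SemidirectProduct.inl : F₂hatT →* Ext i) := rfl

/-- `D_e = N(Π_e × 1)`. [cite: MochizukiAbsTopII2013, Def 1.2 (ii) p.10] -/
theorem dpsc_DvNode (e : (dpsc i hi).Node) :
    (dpsc i hi).DvNode e = Subgroup.normalizer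
      ((nodeGp.map (SemidirectProduct.inl : F₂hatT →* Ext i) : Subgroup (Ext i)) : Set (Ext i)) := rfl

/-- `D_v = N(Π_v × 1)`. [cite: MochizukiAbsTopII2013, Def 1.2 (ii) p.10] -/
theorem dpsc_Dv (v : (dpsc i hi).Vert) :
    (dpsc i hi).Dv v = Subgroup.normalizer
      ((vertGp.map (SemidirectProduct.inl : F₂hatT →* Ext i) : Subgroup (Ext i)) : Set (Ext i)) := rfl

/-! ### Ext-level facts (all types `Subgroup (Ext i)`), then definitional transfer -/

end Dpsc

section ExtLevel

variable (i : ℕ)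

/-- `N(Π_e × 1) = C(Π_e × 1)` in `Π_H`. [cite: MochizukiAbsTopII2013, Prop 1.3 (vii) p.12] -/
theorem normalizer_eq_commensurator_map_inl_nodeGp :
    Subgroup.normalizer ((nodeGp.map (SemidirectProduct.inl : F₂hatT →* Ext i) : Subgroup (Ext i)) : Set (Ext i)) =
      Subgroup.Commensurable.commensurator (nodeGp.map (SemidirectProduct.inl : F₂hatT →* Ext i)) := by
  rw [normalizer_map_inl_nodeGp_eq, commensurator_map_inl_nodeGp_eq]

/-- `Z(Π_e × 1) ∩ Π_I = N(Π_e × 1) ∩ Π_I` (`I_e = D_e ∩ Π_I`) in `Π_H = Π_I`. [cite: MochizukiAbsTopII2013, Prop 1.3 (vii) p.12] -/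
theorem centralizer_inf_top_eq_normalizer_inf_top_nodeGp :
    Subgroup.centralizer ((nodeGp.map (SemidirectProduct.inl : F₂hatT →* Ext i) : Subgroup (Ext i)) : Set (Ext i)) ⊓
        (⊤ : Subgroup (Ext i)) =
      Subgroup.normalizer ((nodeGp.map (SemidirectProduct.inl : F₂hatT →* Ext i) : Subgroup (Ext i)) : Set (Ext i)) ⊓
        (⊤ : Subgroup (Ext i)) := by
  rw [normalizer_map_inl_nodeGp_eq, centralizer_map_inl_nodeGp_eq]

/-- `N(Π_c × 1) = C(Π_c × 1)` in `Π_H`. [cite: MochizukiAbsTopII2013, Prop 1.3 (vii) p.12] -/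
theorem normalizer_eq_commensurator_map_inl_cuspGp :
    Subgroup.normalizer ((cuspGp.map (SemidirectProduct.inl : F₂hatT →* Ext i) : Subgroup (Ext i)) : Set (Ext i)) =
      Subgroup.Commensurable.commensurator (cuspGp.map (SemidirectProduct.inl : F₂hatT →* Ext i)) := by
  rw [normalizer_map_inl_cuspGp_eq, commensurator_map_inl_cuspGp_eq]

/-- The image of `N(S × 1)` in `H = Π_H / (F̂₂ × 1)` is open, for twist-stable `S`.
[cite: MochizukiAbsTopII2013, Prop 1.3 (ix) p.12] -/
theorem isOpen_map_mk'_normalizer_map_inl {S : Subgroup F₂hatT}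
    (hS : ∀ (k : ZH) (s : F₂hatT), s ∈ S → shearPow i k s ∈ S) :
    haveI := normal_range_inl i
    IsOpen (((Subgroup.normalizer ((S.map (SemidirectProduct.inl : F₂hatT →* Ext i) : Subgroup (Ext i)) :
        Set (Ext i))).map (QuotientGroup.mk' (SemidirectProduct.inl : F₂hatT →* Ext i).range) :
          Subgroup (Ext i ⧸ (SemidirectProduct.inl : F₂hatT →* Ext i).range)) :
      Set (Ext i ⧸ (SemidirectProduct.inl : F₂hatT →* Ext i).range)) := by
  haveI := normal_range_inl i
  rw [map_mk'_normalizer_map_inl_eq_top i hS, Subgroup.coe_top]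
  exact isOpen_univ

/-- **`N(Π_v × 1) ∩ Π_I = (1 ⋊ Ẑ) · (Π_v × 1)` iff `N_{F̂₂}(Π_v) = Π_v`** (`D_v = N_{F̂₂}(Π_v) ⋊ Ẑ`).
[cite: MochizukiAbsTopII2013, Prop 1.3 (iii) p.11] -/
theorem normalizer_vert_inf_top_eq_iff :
    Subgroup.normalizer ((vertGp.map (SemidirectProduct.inl : F₂hatT →* Ext i) : Subgroup (Ext i)) : Set (Ext i)) ⊓
          (⊤ : Subgroup (Ext i)) =
        (SemidirectProduct.inr : ZH →* Ext i).range ⊔ vertGp.map (SemidirectProduct.inl : F₂hatT →* Ext i) ↔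
      Subgroup.normalizer (vertGp : Set F₂hatT) = vertGp := by
  rw [inf_top_eq, sup_comm]
  constructor
  · intro h
    refine le_antisymm (fun n hn => ?_) Subgroup.le_normalizer
    have hx : (SemidirectProduct.inl n : Ext i) ∈ Subgroup.normalizer
        ((vertGp.map (SemidirectProduct.inl : F₂hatT →* Ext i) : Subgroup (Ext i)) : Set (Ext i)) := by
      rw [mem_normalizer_map_inl_vertGp_iff, SemidirectProduct.left_inl]; exact hn
    rw [h] at hx
    have hx' := (mem_map_inl_sup_range_inr_iff (shearPow_mem_vertGp_of_mem i) _).mp hx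
    rwa [SemidirectProduct.left_inl] at hx'
  · intro h
    exact normalizer_map_inl_eq_of_normalizer_eq (shearPow_mem_vertGp_of_mem i) h

/-- `(1 ⋊ Ẑ) × (Π_v × 1) = N(Π_v × 1) ∩ Π_I` as an internal direct product, GIVEN `N_{F̂₂}(Π_v) = Π_v`.
[cite: MochizukiAbsTopII2013, Prop 1.3 (iii) p.11] -/
theorem isInternalProduct_vert_ext (hNv : Subgroup.normalizer (vertGp : Set F₂hatT) = vertGp) :
    IsInternalProduct (SemidirectProduct.inr : ZH →* Ext i).range (vertGp.map (SemidirectProduct.inl : F₂hatT →* Ext i))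
      (Subgroup.normalizer ((vertGp.map (SemidirectProduct.inl : F₂hatT →* Ext i) : Subgroup (Ext i)) : Set (Ext i)) ⊓
        (⊤ : Subgroup (Ext i))) := by
  rw [(normalizer_vert_inf_top_eq_iff i).mpr hNv]
  refine ⟨le_sup_left, le_sup_right, ?_, ?_, rfl⟩
  · rintro _ ⟨k, rfl⟩ _ ⟨s, hs, rfl⟩
    refine SemidirectProduct.ext ?_ ?_
    · simp only [SemidirectProduct.mul_left, SemidirectProduct.left_inl, SemidirectProduct.right_inl,
        SemidirectProduct.left_inr, SemidirectProduct.right_inr, map_one, mul_one, one_mul]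
      exact shearPow_mem_vertGp i k s hs
    · simp only [SemidirectProduct.mul_right, SemidirectProduct.right_inl, SemidirectProduct.right_inr, one_mul,
        mul_one]
  · rw [eq_bot_iff, ← range_inr_inf_range_inl i]
    exact le_inf inf_le_left (le_trans inf_le_right (Subgroup.map_le_range _ _))

end ExtLevel

section Transfer

variable {i : ℕ} (hi : 0 < i)

/-! ### Prop 1.3 (vii), (ix), (vi) at `dpsc i hi` -/

/-- **[AbsTopII] Prop 1.3 (vii) — the typed `DPSCData.Prop13vii` (F-0280) — HOLDS at the nodal Dehn-twist datum,
node half AND cusp half, with no hypothesis**: `D_e = C_{Π_H}(Π_e)`, `D_e` commensurably terminal, `I_e = D_e ∩ Π_I`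
(node); `D_c = C_{Π_H}(Π_c)`, `D_c` commensurably terminal (cusp). [cite: MochizukiAbsTopII2013, Prop 1.3 (vii) p.12] -/
theorem prop13vii_dpsc_holds : (dpsc i hi).toDPSCData.Prop13vii :=
  ⟨fun _ => ⟨normalizer_eq_commensurator_map_inl_nodeGp i, isCommensurablyTerminal_normalizer_map_inl_nodeGp i,
      centralizer_inf_top_eq_normalizer_inf_top_nodeGp i⟩,
    fun _ => ⟨normalizer_eq_commensurator_map_inl_cuspGp i, isCommensurablyTerminal_normalizer_map_inl_cuspGp i⟩⟩

/-- **[AbsTopII] Prop 1.3 (ix) — the typed `DPSCData.Prop13ix` (F-0277) — HOLDS at the nodal Dehn-twist datum,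
node AND cusp, with no hypothesis**: the image of `D_e` in `H = Ẑ` is everything (open), and `D_e` is not open in
`Π_H`. [cite: MochizukiAbsTopII2013, Prop 1.3 (ix) p.12] -/
theorem prop13ix_dpsc_holds : (dpsc i hi).toDPSCData.Prop13ix :=
  ⟨fun _ => ⟨isOpen_map_mk'_normalizer_map_inl i (shearPow_mem_nodeGp_of_mem i),
      not_isOpen_normalizer_map_inl_nodeGp i⟩,
    fun _ => ⟨isOpen_map_mk'_normalizer_map_inl i (shearPow_mem_cuspGp_of_mem i),
      not_isOpen_normalizer_map_inl_cuspGp i⟩⟩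

/-- **[AbsTopII] Prop 1.3 (vi) — the typed `DPSCData.Prop13vi` (F-0279) — HOLDS at the nodal Dehn-twist datum with
no hypothesis**: the image of `D_v` in `H = Ẑ` is everything (the twist section normalises `Π_v`); the clause
"`D_v` not open if there are ≥ 2 vertices" is vacuous (one vertex). [cite: MochizukiAbsTopII2013, Prop 1.3 (vi) p.12] -/
theorem prop13vi_dpsc_holds : (dpsc i hi).toDPSCData.Prop13vi :=
  fun v => ⟨isOpen_map_mk'_normalizer_map_inl i (shearPow_mem_vertGp_of_mem i),
    fun ⟨w, hw⟩ => absurd (dpsc_vert_eq hi w v) hw⟩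

/-! ### Prop 1.3 (iii) rest at `dpsc i hi`: the vertex clause modulo `N(Π_v) = Π_v` -/

/-- **The vertex clause "`D_v ∩ Π_I = I_v × Π_v`" of Prop 1.3 (iii) at the nodal datum is EQUIVALENT to the input
«`N_{F̂₂}(Π_v) = Π_v`»** (`D_v = N_{F̂₂}(Π_v) ⋊ Ẑ`, `I_v × Π_v = Π_v ⋊ Ẑ`). [cite: MochizukiAbsTopII2013, Prop 1.3 (iii) p.11] -/
theorem dv_inf_PiI_eq_iff (v : (dpsc i hi).Vert) :
    (dpsc i hi).Dv v ⊓ (dpsc i hi).PiI = (dpsc i hi).Iv v ⊔ (dpsc i hi).vertSub v ↔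
      Subgroup.normalizer (vertGp : Set F₂hatT) = vertGp := by
  rw [Iv_dpsc_eq_range_inr_holds hi]
  exact normalizer_vert_inf_top_eq_iff i

/-- **The typed `Prop_1_3_iii'` (F-0299) at the nodal Dehn-twist datum MODULO the one named input
«`N_{F̂₂}(Π_v) = Π_v`»** ([CombGC] Prop 1.2 (ii) for the verticial subgroup of the loop datum — not in the tree);
the "`I_v ≅ Ẑ^Σ`" clause and the whole cusp clause are unconditional. [cite: MochizukiAbsTopII2013, Prop 1.3 (iii) p.11] -/
theorem prop_1_3_iii'_dpsc_of_normalizer_vertGp_eq (hNv : Subgroup.normalizer (vertGp : Set F₂hatT) = vertGp) :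
    Literature.AnabelianGeometry.AbsoluteAnabelian.AbsTopII.DPSCIndexData.Prop_1_3_iii' (dpsc i hi) := by
  refine ⟨fun v => ?_, prop_1_3_iii'_cusp_dpsc_holds hi⟩
  rw [Iv_dpsc_eq_range_inr_holds hi]
  exact ⟨isInternalProduct_vert_ext i hNv, isFreeProSigmaCyclic_range_inr i⟩

/-- **The scope successor `Prop_1_3_iii''` at the nodal datum MODULO «`N_{F̂₂}(Π_v) = Π_v`»** (cusp clause with
`γ = 1 ∈ Π_𝔾`, unconditional). [cite: MochizukiAbsTopII2013, Prop 1.3 (iii) p.11] -/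
theorem prop_1_3_iii''_dpsc_of_normalizer_vertGp_eq (hNv : Subgroup.normalizer (vertGp : Set F₂hatT) = vertGp) :
    Literature.AnabelianGeometry.AbsoluteAnabelian.AbsTopII.DPSCIndexData.Prop_1_3_iii'' (dpsc i hi) := by
  refine ⟨fun v => ?_, prop_1_3_iii_cusp_dpsc_holds hi⟩
  rw [Iv_dpsc_eq_range_inr_holds hi]
  exact ⟨isInternalProduct_vert_ext i hNv, isFreeProSigmaCyclic_range_inr i⟩

end Transfer


/-! ### Packaging: one nodal datum, seven clauses, no hypothesis -/

/-- **A DPSC datum WITH A NODE at which [AbsTopII] Prop 1.3 (i), (ii) (both typings), (iii) first clause, (vi),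
(vii), (ix) ALL hold, with no hypothesis** (`Σ` = all primes, `Σ`-index `i` of the node prescribed).
[cite: MochizukiAbsTopII2013, Prop 1.3 p.11] -/
theorem exists_nodal_model_prop13_i_vi_vii_ix (i : ℕ) (hi : 0 < i) :
    ∃ X : DPSCIndexData.{0}, Nonempty X.Node ∧ X.Sigma = {p | p.Prime} ∧ (∀ e : X.Node, X.sigmaIndex e = i) ∧
      Literature.AnabelianGeometry.AbsoluteAnabelian.AbsTopII.DPSCIndexData.Prop_1_3_i X ∧
      Literature.AnabelianGeometry.AbsoluteAnabelian.AbsTopII.DPSCIndexData.Prop_1_3_ii' X ∧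
      Literature.AnabelianGeometry.AbsoluteAnabelian.AbsTopII.DPSCIndexData.Prop_1_3_ii X ∧
      X.toDPSCData.Prop13iii ∧ X.toDPSCData.Prop13vi ∧ X.toDPSCData.Prop13vii ∧ X.toDPSCData.Prop13ix :=
  ⟨dpsc i hi, dpsc_node_nonempty i hi, rfl, fun _ => rfl, prop_1_3_i_dpsc_holds hi, prop_1_3_ii'_dpsc_holds hi,
    prop_1_3_ii_dpsc_holds hi, prop13iii_dpsc_holds hi, prop13vi_dpsc_holds hi, prop13vii_dpsc_holds hi,
    prop13ix_dpsc_holds hi⟩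

/-! ### Appended: Prop 1.3 (viii), the `Π_𝔾`-clause at the nodal datum — node and cusp decomposition groups meet
`Π_𝔾` trivially, for EVERY conjugating element -/

section EdgePairs

/-- The `b`-degree `ê_B` kills the commutator axis: `ê_B ≡ 1` on `Π_c = c^Ẑ` (`ê_B(η[a,b]) = ι(expB [a,b]) = 1`,
closed kernel). [cite: MochizukiAbsTopII2013, Prop 1.3 (viii) p.12] -/
theorem eHatB_eq_one_of_mem_cuspGp {x : F₂hatT} (hx : x ∈ cuspGp) : eHatB x = 1 := by
  have hle : Subgroup.zpowers (genA * genB * genA⁻¹ * genB⁻¹) ≤ eHatB.toMonoidHom.ker := by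
    rw [Subgroup.zpowers_le, MonoidHom.mem_ker]
    change eHatB (eta (FreeGroup.of 0) * eta (FreeGroup.of 1) * (eta (FreeGroup.of 0))⁻¹ * (eta (FreeGroup.of 1))⁻¹) = 1
    rw [map_mul, map_mul, map_mul, map_inv, map_inv, eHatB_eta, eHatB_eta, expB_of_zero, expB_of_one, map_one,
      one_mul, inv_one, mul_one, mul_inv_cancel]
  have hcl : IsClosed ((eHatB.toMonoidHom.ker : Subgroup F₂hatT) : Set F₂hatT) := by
    rw [MonoidHom.coe_ker]
    exact isClosed_singleton.preimage eHatB.continuous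
  exact Subgroup.topologicalClosure_minimal _ hle hcl hx

/-- **`b^Ẑ ∩ n·c^Ẑ·n⁻¹ = 1` and `c^Ẑ ∩ n·b^Ẑ·n⁻¹ = 1` for every `n ∈ F̂₂`** (compare `b`-degrees: `ê_B(b^t) = t`,
`ê_B` of any conjugate of an element of `c^Ẑ` is `1`). [cite: MochizukiAbsTopII2013, Prop 1.3 (viii) p.12] -/
theorem nodeGp_inf_conj_cuspGp_eq_bot (n : F₂hatT) : nodeGp ⊓ MulAut.conj n • cuspGp = ⊥ := by
  rw [eq_bot_iff]
  intro x hx'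
  obtain ⟨hxb, hx⟩ := Subgroup.mem_inf.mp hx'
  obtain ⟨t, rfl⟩ := hxb
  rw [Subgroup.mem_smul_pointwise_iff_exists] at hx
  obtain ⟨c, hc, hcx⟩ := hx
  rw [MulAut.smul_def, MulAut.conj_apply] at hcx
  have h1 : eHatB (n * c * n⁻¹) = 1 := by
    rw [map_mul, map_mul, map_inv, eHatB_eq_one_of_mem_cuspGp hc, mul_one, mul_inv_cancel]
  rw [hcx] at h1
  change eHatB (bPow t) = 1 at h1
  rw [eHatB_bPow] at h1
  rw [Subgroup.mem_bot, h1]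
  exact map_one bPow

/-- The symmetric form: `c^Ẑ ∩ n·b^Ẑ·n⁻¹ = 1`. [cite: MochizukiAbsTopII2013, Prop 1.3 (viii) p.12] -/
theorem cuspGp_inf_conj_nodeGp_eq_bot (n : F₂hatT) : cuspGp ⊓ MulAut.conj n • nodeGp = ⊥ := by
  rw [eq_bot_iff]
  intro x hx'
  obtain ⟨hxc, hx⟩ := Subgroup.mem_inf.mp hx'
  rw [Subgroup.mem_smul_pointwise_iff_exists] at hx
  obtain ⟨_, ⟨t, rfl⟩, hbx⟩ := hx
  rw [MulAut.smul_def, MulAut.conj_apply] at hbx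
  have h1 : eHatB x = 1 := eHatB_eq_one_of_mem_cuspGp hxc
  rw [← hbx, map_mul, map_mul, map_inv] at h1
  change eHatB n * eHatB (bPow t) * (eHatB n)⁻¹ = 1 at h1
  rw [eHatB_bPow, ZHatCompletion.mul_comm (eHatB n) t, mul_assoc, mul_inv_cancel, mul_one] at h1
  rw [Subgroup.mem_bot, ← hbx]
  change n * bPow t * n⁻¹ = 1
  rw [h1, map_one, mul_one, mul_inv_cancel]

variable (i : ℕ)

/-- In `Π_H`: the `Π_𝔾`-part of a `Π_H`-conjugate of `S × 1` is the conjugate of `S` by the left factor — for a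
twist-FIXED `S` and ANY `γ ∈ Π_H`: `γ·(S × 1)·γ⁻¹ = (γ.left·S·γ.left⁻¹) × 1`.
[cite: MochizukiAbsTopII2013, Prop 1.3 (viii) p.12] -/
theorem conj_smul_map_inl_of_fixed {S : Subgroup F₂hatT} (hS : ∀ (k : ZH), ∀ s ∈ S, shearPow i k s = s) (γ : Ext i) :
    MulAut.conj γ • S.map (SemidirectProduct.inl : F₂hatT →* Ext i) =
      (MulAut.conj γ.left • S).map (SemidirectProduct.inl : F₂hatT →* Ext i) :=
  conj_smul_map_inl (fun k s hs => by rw [hS k s hs]; exact hs) γ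

/-- **Prop 1.3 (viii), `Π_𝔾`-clause, at the nodal datum, for EVERY `γ ∈ Π_H`: `D_e ∩ γ·D_c·γ⁻¹ ∩ Π_𝔾 = 1`** for the
node `e` and the cusp `c` (in `Π_H`: `D_e = b^Ẑ ⋊ Ẑ`, `D_c = c^Ẑ ⋊ Ẑ`). [cite: MochizukiAbsTopII2013, Prop 1.3 (viii) p.12] -/
theorem normalizer_node_inf_conj_normalizer_cusp_inf_range_inl (γ : Ext i) :
    Subgroup.normalizer ((nodeGp.map (SemidirectProduct.inl : F₂hatT →* Ext i) : Subgroup (Ext i)) : Set (Ext i)) ⊓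
        MulAut.conj γ • Subgroup.normalizer ((cuspGp.map (SemidirectProduct.inl : F₂hatT →* Ext i) :
          Subgroup (Ext i)) : Set (Ext i)) ⊓
        (SemidirectProduct.inl : F₂hatT →* Ext i).range = ⊥ := by
  rw [eq_bot_iff]
  intro x hx'
  obtain ⟨hx12, hx3⟩ := Subgroup.mem_inf.mp hx'
  obtain ⟨hxn, hxc⟩ := Subgroup.mem_inf.mp hx12
  obtain ⟨m, rfl⟩ := hx3
  rw [normalizer_map_inl_nodeGp_eq, mem_map_inl_sup_range_inr_iff (shearPow_mem_nodeGp_of_mem i),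
    SemidirectProduct.left_inl] at hxn
  rw [normalizer_map_inl_cuspGp_eq, Subgroup.mem_smul_pointwise_iff_exists] at hxc
  obtain ⟨y, hy, hyx⟩ := hxc
  rw [mem_map_inl_sup_range_inr_iff (shearPow_mem_cuspGp_of_mem i)] at hy
  rw [MulAut.smul_def, MulAut.conj_apply] at hyx
  -- compare right components: `y.right = 1`, so `y = inl y.left`
  have hr := congrArg SemidirectProduct.right hyx
  simp only [SemidirectProduct.mul_right, SemidirectProduct.inv_right, SemidirectProduct.right_inl] at hr
  rw [ZHatCompletion.mul_comm γ.right y.right, mul_assoc, mul_inv_cancel, mul_one] at hr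
  have hy' : y = SemidirectProduct.inl y.left := by
    rw [← SemidirectProduct.inl_left_mul_inr_right y, hr, map_one, mul_one, SemidirectProduct.left_inl]
  rw [hy', conj_inl_eq, shearPow_mem_cuspGp i γ.right _ hy] at hyx
  have hl := SemidirectProduct.inl_injective hyx
  -- `m ∈ b^Ẑ ∩ γ.left·c^Ẑ·γ.left⁻¹ = 1`
  have hm2 : m ∈ MulAut.conj γ.left • cuspGp := by
    rw [Subgroup.mem_smul_pointwise_iff_exists]
    exact ⟨y.left, hy, by rw [MulAut.smul_def, MulAut.conj_apply, hl]⟩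
  have hm : m ∈ nodeGp ⊓ MulAut.conj γ.left • cuspGp := Subgroup.mem_inf.mpr ⟨hxn, hm2⟩
  rw [nodeGp_inf_conj_cuspGp_eq_bot] at hm
  rw [Subgroup.mem_bot] at hm ⊢
  rw [hm, map_one]

variable {i} (hi : 0 < i)

/-- **The `Π_𝔾`-clause of the typed `Prop_1_3_viii'` at `dpsc i hi` for the pair (node, cusp), for EVERY conjugating
`γ ∈ Π_H`** (so a fortiori for `γ ∈ Π_𝔾`): `D_e ∩ γD_cγ⁻¹ ∩ Π_𝔾 = 1`.  (The `I_v`-clause of (viii′) is NOT claimed: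
see the file docstring's successor note.) [cite: MochizukiAbsTopII2013, Prop 1.3 (viii) p.12] -/
theorem DEdge_node_inf_conj_DEdge_cusp_inf_PiG_dpsc (e : (dpsc i hi).Node) (c : (dpsc i hi).Cusp)
    (γ : (dpsc i hi).PiH) :
    (dpsc i hi).DEdge (Sum.inl e) ⊓ MulAut.conj γ • (dpsc i hi).DEdge (Sum.inr c) ⊓ (dpsc i hi).PiG = ⊥ :=
  normalizer_node_inf_conj_normalizer_cusp_inf_range_inl i γ

end EdgePairs

end Literature.AnabelianGeometry.AbsoluteAnabelian.AbsTopII.DehnTwist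

end
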